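import Summits.QuantumFields.BalabanUV.T4Continuum.Support.GradedSubBlocks
import Summits.QuantumFields.BalabanUV.T4Continuum.Support.LineAveragingPairing

/-!
# T⁴ programme, spine node NE2 (U1a), sub-row Δ1 «the graded well» — THE TWO-LEVEL PAIRING IDENTITY OF BAŁABAN's STRAIGHT-CONTOUR
# AVERAGE AT AN ARBITRARY SCALE `s`: `√(L^d)·(Q_{L·s} J_L f)(L·z, μ) = (Q_s (1 + c_L(S_1 − 1)) f)(z, μ)`, `c_L = (L−1)/(2L)`
# (the scale-`s` twin of `LineAveragingPairing.sqrt_smul_QvOp_mul_JK`, on the row-owner's `GradedSubBlocks.avgS`)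

NE2 formalisation swarm `b2b-balaban-t4-ne2-formalise-*`, LEAF PROVER 03 (gen 9): socket **(GW-L)** of the row owner's RULING R47 (e) / R48 (c)
(journal 2026-08-21 l.25022 / l.25393: «(GW-L) `‖localGW(k+1)⁻¹·JGW k − JGW k·localGW(k)⁻¹‖ ≤ Cl·L^{−k}` → leaf-03 / leaf-01 … per-scale
mass law = `sqrt_smul_QvOp_mul_JK` shape with the c_L(S_1 − 1) transfer»), PART 1 «(GW-L-comm): the scale-`s` pairing identity» (INTENT l.25884;
statement sketch l.25499).  The GRADED WELL (owner files `GradedSubBlocks` p244783, `GradedWellData`) puts on layer `i` the straight-contour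
averages `avgS` at the scale `s_i = L^{k−i}` with weight `a·L^{2i}·s_i^d`; its local two-level law needs, per scale, how the scale-`L·s`
average at level `k+1` reads King's piecewise-constant planting `J_L` of a level-`k` field.  THIS FILE proves the EXACT identity, pointwise
at a pair of anchors `(z, L·z)`:

 * §1 **`par_site_glue_add_tstep`**: the `L`-block parent of the fine point `site (L·z) (L·j + r) + t e_μ` (`t` FINE steps along the
   straight contour) is the coarse point `site z j + ⌊(r_μ + t)/L⌋ e_μ` — the scale-`s` twin of `LineAveragingPairing.par_bpt_glue_add_tstep`
   (both tori wrap compatibly);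
 * §2 **`sqrt_smul_avgS_JK_apply (hs : s ∣ n) … (hzL : ∀ ν, (zL ν).val = L·(z ν).val)`**:
   `√(L^d)·(avgS (fine (L·n) M) (L·s) (J_L f))(zL, μ) = (avgS (fine n M) s ((1 + c_L(S_1 − 1)) f))(z, μ)` — averaging the planted
   field over the REFINED straight contour of length `L·s` weighs the `s` coarse bonds by `L²` each, except for the boundary transfer of
   weight `L(L−1)/2` from the first coarse bond to the one AFTER the contour (`tent_count`, `sum_fun_coord`, `sum_glue` BY NAME).
   At `s = n` (anchors = block corners) this is `sqrt_smul_QvOp_mul_JK` read pointwise.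

The pointwise form is deliberate: the bijection «scale-`s` anchors at level `k` ≃ scale-`L·s` anchors at level `k+1`» is the owner's
`GradedWellTwoLevel.rowVLift` (file 4, staged); whoever assembles (GW-L-comm) instantiates `zL := lift z` there.  PART 2 (not here): with this
identity the graded-mass commutator `M_{k+1}J − J M_k` per layer reduces to `(1 − JJᴴ)`-terms + the `c_L` boundary transfer, bounded by the
layer argument of `LineAveragingMassCommutator` (numerics of the cell: `‖J·M_k − M_{k+1}·J‖ ≈ 59/n_k` at L = 2, m = 2; memo
`t4/T4-EST-NE2-D1-COLLAR-SEAT2.md` §3.3).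

HONEST FRAMING (T4-DAG p. 1).  [folklore] finite-torus counting over landed modules; an IDENTITY about OUR typed averaging objects at `U = 1`;
no estimate, no rate, no two-level LAW yet; NE2 (U1a) NOT proved; spine PROVED 0/9 unchanged; NOT [B9] (3.16)/(3.23)–(3.27)/(3.42) as printed;
NOT infinite volume / mass gap / Clay.  HONEST DEPENDENCY: continuum YM on T⁴ ⇐ BetaPertH ∧ nine spine estimates (0/9 proved); BetaPertH ⇐
(D1) ∧ (D4) ∧ CAP+tail; G-an2-4 gates asym, D1 and NE2/3/4.  No `sorry`.
-/

noncomputable section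

open scoped BigOperators ComplexConjugate Matrix
open Finset

namespace Summit.QuantumFields.BalabanUV.T4Continuum.GradedLineAveragingPairing

open Literature.MathematicalPhysics.QuantumFieldTheory.Balaban1983to89.B5Prop11Plancherel (Tor fine unitVec)
open Literature.MathematicalPhysics.QuantumFieldTheory.Balaban1983to89.B5Block118 (tstep tstep_zero tstep_succ sum_fin_telescope)
open Summit.QuantumFields.BalabanUV.T4Continuum
open Summit.QuantumFields.BalabanUV.T4Continuum.BalabanAveragedTowerModes (par)
open Summit.QuantumFields.BalabanUV.T4Continuum.BalabanLineAverage (shiftT)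
open Summit.QuantumFields.BalabanUV.T4Continuum.BlockPairingGeometry (parT)
open Summit.QuantumFields.BalabanUV.T4Continuum.KingPairingPlantedLaw (JK)
open Summit.QuantumFields.BalabanUV.T4Continuum.LineAveragingPairing (mod_mul_div tent_count sum_fun_coord glue glue_val sum_glue
  JK_mulVec shiftT_mulVec cL)
open Summit.QuantumFields.BalabanUV.T4Continuum.GradedSubBlocks (Anchor Anc site avgS avgS_mulVec)

variable {d : ℕ} (n L s : ℕ) [NeZero n] [NeZero L] (M : Fin d → ℕ) [hM : ∀ μ, NeZero (M μ)]

/-! ## §1 The parent of a point of a refined scale-`s` contour -/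

/-- **THE PARENT OF A POINT OF A REFINED SCALE-`s` CONTOUR**: for a level-`k` site `z` and its `L`-LIFT `zL` (`(zL)_ν = L·z_ν` as values),
the `L`-block parent of the fine point `site zL (L·j + r) + t e_μ` is `site z j + ⌊(r_μ + t)/L⌋ e_μ` — uniformly in `t ∈ ℕ`.
[cite: Balaban1984PropagatorsI, (1.18) p.20; King1986, (2.10) p.653 (shapes)] [folklore] -/
theorem par_site_glue_add_tstep {z : Tor (fine n M)} {zL : Tor (fine (L * n) M)} (hzL : ∀ ν, (zL ν).val = L * (z ν).val)
    (j : Fin d → Fin s) (r : Fin d → Fin L) (μ : Fin d) (t : ℕ) :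
    par n L M (site (fine (L * n) M) (L * s) zL (glue s L (j, r)) + tstep (fine (L * n) M) μ t)
      = site (fine n M) s z j + tstep (fine n M) μ (((r μ : ℕ) + t) / L) := by
  have hL : 0 < L := Nat.pos_of_ne_zero (NeZero.ne L)
  funext ν
  have hB : 0 < n * M ν := Nat.pos_of_ne_zero (NeZero.ne (fine n M ν))
  set δ : ℕ := if ν = μ then t else 0 with hδ
  set A : ℕ := ((z ν).val + (j ν : ℕ)) + ((r ν : ℕ) + δ) / L with hA
  have e1 : (L * (z ν).val + (L * (j ν : ℕ) + (r ν : ℕ)) + δ : ℕ) = L * A + ((r ν : ℕ) + δ) % L := by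
    calc (L * (z ν).val + (L * (j ν : ℕ) + (r ν : ℕ)) + δ : ℕ)
        = L * ((z ν).val + (j ν : ℕ)) + ((r ν : ℕ) + δ) := by ring
      _ = L * ((z ν).val + (j ν : ℕ)) + (L * (((r ν : ℕ) + δ) / L) + ((r ν : ℕ) + δ) % L) := by rw [Nat.div_add_mod]
      _ = L * A + ((r ν : ℕ) + δ) % L := by rw [hA]; ring
  have hzLν : zL ν = (((L * (z ν).val : ℕ)) : ZMod (fine (L * n) M ν)) := by
    rw [← hzL ν, ZMod.natCast_zmod_val]
  have hX : (site (fine (L * n) M) (L * s) zL (glue s L (j, r)) + tstep (fine (L * n) M) μ t) ν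
      = ((L * A + ((r ν : ℕ) + δ) % L : ℕ) : ZMod (fine (L * n) M ν)) := by
    rw [← e1, Pi.add_apply]
    simp only [site, glue_val, tstep, hδ, hzLν]
    split_ifs with h
    · push_cast; ring
    · push_cast; ring
  have hAcast : ((A : ℕ) : ZMod (fine n M ν))
      = z ν + ((j ν : ℕ) : ZMod (fine n M ν)) + (((((r ν : ℕ) + δ) / L : ℕ)) : ZMod (fine n M ν)) := by
    rw [hA, Nat.cast_add, Nat.cast_add, ZMod.natCast_zmod_val]
  have hY : (site (fine n M) s z j + tstep (fine n M) μ (((r μ : ℕ) + t) / L)) ν = ((A : ℕ) : ZMod (fine n M ν)) := by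
    rw [hAcast, Pi.add_apply]
    simp only [site, tstep]
    split_ifs with h
    · subst h
      rw [show δ = t from by rw [hδ, if_pos rfl]]
    · rw [show δ = 0 from by rw [hδ, if_neg h], Nat.add_zero, Nat.div_eq_of_lt (r ν).isLt, Nat.cast_zero, add_zero]
  show ((((site (fine (L * n) M) (L * s) zL (glue s L (j, r)) + tstep (fine (L * n) M) μ t) ν).val / L : ℕ) : ZMod (fine n M ν)) = _
  rw [hX, hY, ZMod.val_natCast, show fine (L * n) M ν = L * (n * M ν) from Nat.mul_assoc _ _ _,
    mod_mul_div L A _ _ hL hB (Nat.mod_lt _ hL)]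
  exact ZMod.natCast_mod A (n * M ν)

/-! ## §2 The pairing identity at scale `s` -/

/-- **THE TWO-LEVEL PAIRING IDENTITY AT SCALE `s`** (exact; every `n, L, s ≥ 1` with `s ∣ n`, every torus `M`, dimension `d`): for a
scale-`s` anchor `z` of the level-`k` torus and its `L`-lift `zL` (a scale-`L·s` anchor of the level-`k+1` torus with `(zL)_ν = L·z_ν`),
`√(L^d)·(avgS_{L·s} (J_L f))(zL, μ) = (avgS_s ((1 + c_L(S_1 − 1)) f))(z, μ)`, `c_L = (L−1)/(2L)`, `(S_1 f)(x, μ) = f(x + e_μ, μ)` —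
Bałaban's (1.18) straight-contour average at scale `L·s` of King's piecewise-constant planting is the scale-`s` average plus the boundary
transfer `c_L·avgS_s(S_1 − 1)`.  Statement and proof OURS (= `LineAveragingPairing.sqrt_smul_QvOp_mul_JK` at every scale).
[cite: Balaban1984PropagatorsI, (1.18) p.20; King1986, p.664, (2.10) p.653 (shapes)] [folklore] -/
theorem sqrt_smul_avgS_JK_apply [NeZero s] (hs : s ∣ n) (f : Tor (fine n M) × Fin d → ℂ) (z : Anc (fine n M) s)
    (zL : Anc (fine (L * n) M) (L * s)) (hzL : ∀ ν, (zL.1 ν).val = L * (z.1 ν).val) (μ : Fin d) :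
    (((Real.sqrt ((L : ℝ) ^ d)) : ℝ) : ℂ) * (avgS (fine (L * n) M) (L * s) *ᵥ (JK n L M *ᵥ f)) (zL, μ)
      = (avgS (fine n M) s *ᵥ ((1 + cL L • (shiftT (fine n M) 1 - 1)) *ᵥ f)) (z, μ) := by
  have hL : 0 < L := Nat.pos_of_ne_zero (NeZero.ne L)
  have hLc : (L : ℂ) ≠ 0 := by exact_mod_cast hL.ne'
  have hsc : (s : ℂ) ≠ 0 := by exact_mod_cast NeZero.ne s
  obtain ⟨_, hss⟩ := KingPairingPlantedLaw.sqrt_facts (d := d) L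
  have hsn : ∀ ν, s ∣ fine n M ν := fun ν => Dvd.dvd.mul_right hs (M ν)
  have hLs : ∀ ν, L * s ∣ fine (L * n) M ν := fun ν => by
    show L * s ∣ L * n * M ν
    exact Dvd.dvd.mul_right (Nat.mul_dvd_mul_left L hs) (M ν)
  set F : (Fin d → Fin s) → ℕ → ℂ := fun j u => f (site (fine n M) s z.1 j + tstep (fine n M) μ u, μ) with hF
  have key : ∀ j : Fin d → Fin s,
      (L : ℂ) * ∑ r : Fin d → Fin L, ∑ t : Fin (L * s),
          f (par n L M (site (fine (L * n) M) (L * s) zL.1 (glue s L (j, r)) + tstep (fine (L * n) M) μ t), μ)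
        = (L : ℂ) ^ d * ((L : ℂ) ^ 2 * ∑ u ∈ range s, F j u + (∑ ρ ∈ range L, (ρ : ℂ)) * (F j s - F j 0)) := by
    intro j
    simp_rw [par_site_glue_add_tstep n L s M hzL]
    have e1 : ∀ r : Fin d → Fin L, ∑ t : Fin (L * s), f (site (fine n M) s z.1 j + tstep (fine n M) μ (((r μ : ℕ) + t) / L), μ)
        = ∑ t ∈ range (L * s), F j (((r μ : ℕ) + t) / L) := fun r =>
      Fin.sum_univ_eq_sum_range (fun t => F j (((r μ : ℕ) + t) / L)) (L * s)
    simp_rw [e1]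
    rw [sum_fun_coord L μ (fun ρ : Fin L => ∑ t ∈ range (L * s), F j (((ρ : ℕ) + t) / L)),
      Fin.sum_univ_eq_sum_range (fun ρ => ∑ t ∈ range (L * s), F j ((ρ + t) / L)) L, tent_count (F j) L s hL]
  have key' : ∀ j : Fin d → Fin s,
      ∑ r : Fin d → Fin L, ∑ t : Fin (L * s),
          f (par n L M (site (fine (L * n) M) (L * s) zL.1 (glue s L (j, r)) + tstep (fine (L * n) M) μ t), μ)
        = (L : ℂ) ^ d * ((L : ℂ) ^ 2 * ∑ u ∈ range s, F j u + (∑ ρ ∈ range L, (ρ : ℂ)) * (F j s - F j 0)) / L := by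
    intro j
    rw [eq_div_iff hLc, mul_comm, key j]
  -- the left side
  rw [avgS_mulVec _ _ hLs]
  simp only [JK_mulVec, parT, ← Finset.mul_sum]
  rw [sum_glue s L (fun j' => ∑ t : Fin (L * s),
    f (par n L M (site (fine (L * n) M) (L * s) zL.1 j' + tstep (fine (L * n) M) μ t), μ))]
  simp_rw [key']
  -- the right side
  rw [avgS_mulVec _ _ hsn]
  have e3 : ∀ (j : Fin d → Fin s) (t : Fin s),
      ((1 + cL L • (shiftT (fine n M) 1 - 1)) *ᵥ f) (site (fine n M) s z.1 j + tstep (fine n M) μ t, μ)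
        = F j t + cL L * (F j ((t : ℕ) + 1) - F j t) := by
    intro j t
    rw [Matrix.add_mulVec, Matrix.one_mulVec, Matrix.smul_mulVec, Matrix.sub_mulVec, Matrix.one_mulVec]
    simp only [Pi.add_apply, Pi.smul_apply, Pi.sub_apply, smul_eq_mul, shiftT_mulVec, hF]
    rw [BalabanLineAverage.tstep_one, tstep_succ, add_assoc]
  simp_rw [e3]
  have e4 : ∀ j : Fin d → Fin s, ∑ t : Fin s, (F j t + cL L * (F j ((t : ℕ) + 1) - F j t))
      = ∑ u ∈ range s, F j u + cL L * (F j s - F j 0) := by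
    intro j
    rw [sum_add_distrib, ← Finset.mul_sum, sum_fin_telescope (F j) s, Fin.sum_univ_eq_sum_range (fun u => F j u) s]
  simp_rw [e4]
  -- the arithmetic
  set sq : ℂ := (((Real.sqrt ((L : ℝ) ^ d)) : ℝ) : ℂ) with hsq
  have hre : ∀ A B : ℂ, sq * (A * (sq * B)) = (sq * sq) * (A * B) := fun A B => by ring
  rw [hre, hss]
  have hS : ∑ x : Fin d → Fin s, (L : ℂ) ^ d * ((L : ℂ) ^ 2 * ∑ u ∈ range s, F x u
        + (∑ ρ ∈ range L, (ρ : ℂ)) * (F x s - F x 0)) / L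
      = (L : ℂ) ^ (d + 1) * ∑ x : Fin d → Fin s, (∑ u ∈ range s, F x u + cL L * (F x s - F x 0)) := by
    rw [Finset.mul_sum]
    refine Finset.sum_congr rfl fun x _ => ?_
    rw [cL]
    field_simp
    ring
  rw [hS]
  push_cast
  field_simp
  ring

end Summit.QuantumFields.BalabanUV.T4Continuum.GradedLineAveragingPairing

end
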